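import Summits.ValiantsHypothesis.ValiantsHypothesis.Theses.BarrierLever

/-!
# ValiantsHypothesis / BarrierLever — support `LevelCollapse` (item stmt-ValiantsHypothesis-8747)

Uniform collapse of boolean sums at the coefficient scale under `VP = VNP`:
if `¬ (VP_ℂ ≠ VNP_ℂ)` then for every level `a` there are `a', n₁` such that for all `n ≥ n₁`,
every `q ≤ N^a` (`N = C(2n,n)`) and every `H` in the `N` coefficient variables and `q` boolean
variables with `L(H), deg H ≤ N^a` has `boolSum H ∈ Distinguishers ℂ n a'`.

Proof (diagonalisation, no VNP-completeness of the permanent): `deg (boolSum H) ≤ deg H`; if the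
complexity bound failed for every `a'`, pick for each `n` a datum bad at the largest level `≤ n`
(`Nat.findGreatest`); the family `M ↦ boolSum (H (log₂ M))` on the variables
`degLEMonomials (log₂ M) ⊕ Fin (q (log₂ M))` (card `≤ 8^(log₂ M) ≤ (M+1)^3` by stars and bars) is
p-definable, hence p-computable under `VP = VNP` with some exponent `c`; querying the failure at
level `a + c + 1` and `M = 2^n` contradicts `2^n ≤ C(2n,n)`.  This is the argument the route's
deciding theorem `closes` carries inline (planner glue, rev 6); here it is re-filed as the
standalone support theorem so that the item closes by name.
-/

namespace Summit.ValiantsHypothesis.Theorems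

/-- **LevelCollapse** (route BarrierLever, support item stmt-ValiantsHypothesis-8747): under
`VP_ℂ = VNP_ℂ`, boolean sums of level `a` in the `N = C(2n,n)` coefficient variables collapse
uniformly (eventually in `n`) into distinguishers of some level `a'`.  Diagonalisation over the
p-definable family `M ↦ boolSum (H (log₂ M))`; no completeness of the permanent is used
(Bürgisser 2000 Ch. 2 for p-definability; Forbes–Shpilka–Volk 2018 Def. 1 for distinguishers). -/
theorem levelCollapse_proof :
    Summit.ValiantsHypothesis.ValiantsHypothesis.Theses.BarrierLever.LevelCollapse := by
  classical
  unfold Summit.ValiantsHypothesis.ValiantsHypothesis.Theses.BarrierLever.LevelCollapse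
  intro hV a
  unfold _root_.ValiantsHypothesis Literature.PNP.ValiantHypothesis at hV
  have hVeq := not_not.mp hV
  have hNpos : ∀ n, 0 < (2 * n).choose n := fun n => Nat.choose_pos (by omega)
  have hcb : ∀ n, 2 ^ n ≤ (2 * n).choose n := by
    intro n
    rw [← Nat.centralBinom_eq_two_mul_choose]
    induction n with
    | zero => simp
    | succ n ih =>
      have h2 : (n + 1) * (2 * 2 ^ n) ≤ (n + 1) * Nat.centralBinom (n + 1) := by
        rw [Nat.succ_mul_centralBinom_succ]
        calc (n + 1) * (2 * 2 ^ n) = (2 * n + 2) * 2 ^ n := by ring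
          _ ≤ (2 * (2 * n + 1)) * 2 ^ n := Nat.mul_le_mul_right _ (by omega)
          _ ≤ 2 * (2 * n + 1) * Nat.centralBinom n := Nat.mul_le_mul_left _ ih
      calc 2 ^ (n + 1) = 2 * 2 ^ n := by ring
        _ ≤ Nat.centralBinom (n + 1) := Nat.le_of_mul_le_mul_left h2 (Nat.succ_pos n)
  have hDmono : ∀ n i j, i ≤ j → Literature.Barriers.ValiantsHypothesis.Distinguishers ℂ n i ⊆
      Literature.Barriers.ValiantsHypothesis.Distinguishers ℂ n j := by
    intro n i j h D hD
    simp only [Literature.Barriers.ValiantsHypothesis.Distinguishers, Set.mem_setOf_eq] at hD ⊢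
    exact ⟨hD.1.trans (Nat.pow_le_pow_right (hNpos n) h), hD.2.trans (Nat.pow_le_pow_right (hNpos n) h)⟩
  have hdegB : ∀ (σ : Type) (m : ℕ) (g : MvPolynomial (σ ⊕ Fin m) ℂ),
      (Literature.Computability.AlgebraicComplexity.boolSum g).totalDegree ≤ g.totalDegree := by
    intro σ m g
    unfold Literature.Computability.AlgebraicComplexity.boolSum
    refine MvPolynomial.totalDegree_finsetSum_le fun e _ => ?_
    conv_lhs => rw [g.as_sum]
    rw [map_sum]
    refine MvPolynomial.totalDegree_finsetSum_le fun d hd => ?_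
    rw [MvPolynomial.aeval_monomial, MvPolynomial.algebraMap_eq]
    refine (MvPolynomial.totalDegree_mul _ _).trans ?_
    rw [MvPolynomial.totalDegree_C, zero_add, Finsupp.prod]
    refine ((MvPolynomial.totalDegree_finsetProd _ _).trans (Finset.sum_le_sum fun i _ =>
      (MvPolynomial.totalDegree_pow _ _).trans (Nat.mul_le_mul_left (d i) (?_ : _ ≤ 1)))).trans ?_
    · rcases i with i | j
      · simp only [Sum.elim_inl]; exact (MvPolynomial.totalDegree_X (R := ℂ) i).le
      · simp only [Sum.elim_inr]; split_ifs <;> simp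
    · simp only [mul_one]; exact MvPolynomial.le_totalDegree hd
  obtain ⟨S, hS, hS8⟩ : ∃ S : ∀ m : ℕ, Finset (Fin m →₀ ℕ),
      (∀ m, Literature.Barriers.ValiantsHypothesis.degLEMonomials m ⊆ ↑(S m)) ∧ ∀ m, (S m).card ≤ 8 ^ m := by
    refine ⟨fun m => (Finset.range (m + 1)).biUnion fun d => Finset.univ.finsuppAntidiag d,
      fun m x hx => ?_, fun m => ?_⟩
    · simp only [Literature.Barriers.ValiantsHypothesis.degLEMonomials, Set.mem_setOf_eq] at hx
      refine Finset.mem_coe.2 (Finset.mem_biUnion.2 ⟨x.degree, Finset.mem_range.2 (by omega), ?_⟩)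
      exact Finset.mem_finsuppAntidiag.2 ⟨(Finsupp.degree_eq_sum x).symm, Finset.subset_univ _⟩
    · refine Finset.card_biUnion_le.trans ?_
      calc ∑ d ∈ Finset.range (m + 1), (Finset.univ.finsuppAntidiag d).card
          ≤ ∑ _d ∈ Finset.range (m + 1), 4 ^ m := by
            refine Finset.sum_le_sum fun d hd => ?_
            rw [Finset.card_finsuppAntidiag_nat_eq_choose, Finset.card_univ, Fintype.card_fin]
            have hd' : d ≤ m := Nat.lt_succ_iff.mp (Finset.mem_range.mp hd)
            calc (m + d - 1).choose d ≤ 2 ^ (m + d - 1) := Nat.choose_le_two_pow _ _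
              _ ≤ 2 ^ (2 * m) := Nat.pow_le_pow_right (by norm_num) (by omega)
              _ = 4 ^ m := by rw [pow_mul]; norm_num
        _ = (m + 1) * 4 ^ m := by rw [Finset.sum_const, Finset.card_range, smul_eq_mul]
        _ ≤ 2 ^ m * 4 ^ m := Nat.mul_le_mul_right _ (Nat.succ_le_of_lt Nat.lt_two_pow_self)
        _ = 8 ^ m := by rw [← mul_pow]; norm_num
  have inst : ∀ m, Fintype ↥(Literature.Barriers.ValiantsHypothesis.degLEMonomials m) := fun m =>
    ((S m).finite_toSet.subset (hS m)).fintype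
  have h2ℓ : ∀ M, 2 ^ Nat.log 2 M ≤ M + 1 := fun M => Nat.pow_log_le_add_one 2 M
  have hpw : ∀ k ℓ : ℕ, (2 ^ k) ^ ℓ = (2 ^ ℓ) ^ k := fun k ℓ => by rw [← pow_mul, mul_comm, pow_mul]
  have hNMa : ∀ M, ((2 * Nat.log 2 M).choose (Nat.log 2 M)) ^ a ≤ (M + 1) ^ (2 * a) := fun M => by
    rw [pow_mul]
    refine Nat.pow_le_pow_left ?_ a
    calc (2 * Nat.log 2 M).choose (Nat.log 2 M) ≤ 2 ^ (2 * Nat.log 2 M) := Nat.choose_le_two_pow _ _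
      _ = (2 ^ Nat.log 2 M) ^ 2 := by rw [pow_mul, hpw]
      _ ≤ (M + 1) ^ 2 := Nat.pow_le_pow_left (h2ℓ M) 2
  have hcardM : ∀ M, Fintype.card ↥(Literature.Barriers.ValiantsHypothesis.degLEMonomials (Nat.log 2 M))
      ≤ (M + 1) ^ 3 := fun M => by
    rw [← Set.toFinset_card]
    refine ((Finset.card_le_card (Set.toFinset_subset.mpr (hS _))).trans (hS8 _)).trans ?_
    calc 8 ^ Nat.log 2 M = (2 ^ Nat.log 2 M) ^ 3 := by rw [← hpw]; norm_num
      _ ≤ (M + 1) ^ 3 := Nat.pow_le_pow_left (h2ℓ M) 3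
  have pb : ∀ (t : ℕ → ℕ) (A B : ℕ), (∀ M, t M ≤ A * (M + 1) ^ B) →
      Literature.Computability.AlgebraicComplexity.IsPBounded t := fun t A B h =>
    (Literature.Computability.AlgebraicComplexity.IsPBounded.iff_exists_le_mul_succ_pow t).2 ⟨A, B, h⟩
  have hmo : ∀ M i j, i ≤ j → (M + 1) ^ i ≤ (M + 1) ^ j := fun M i j h =>
    Nat.pow_le_pow_right (Nat.succ_pos M) h
  -- the "bad datum" predicate, introduced opaquely
  obtain ⟨P, hP⟩ : ∃ P : ℕ → ℕ → Prop, ∀ n a', (P n a' ↔ ∃ q : ℕ, q ≤ (2 * n).choose n ^ a ∧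
      ∃ H : MvPolynomial (↥(Literature.Barriers.ValiantsHypothesis.degLEMonomials n) ⊕ Fin q) ℂ,
        Literature.Computability.AlgebraicComplexity.complexity H ≤ (2 * n).choose n ^ a ∧
        H.totalDegree ≤ (2 * n).choose n ^ a ∧ Literature.Computability.AlgebraicComplexity.boolSum H ∉
          Literature.Barriers.ValiantsHypothesis.Distinguishers ℂ n a') := ⟨_, fun _ _ => Iff.rfl⟩
  by_contra hcon
  push Not at hcon
  have hcon' : ∀ a' n₁, ∃ n, n₁ ≤ n ∧ P n a' := by
    intro a' n₁
    obtain ⟨n, hn, q, hq, H, hHc, hHd, hnot⟩ := hcon a' n₁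
    exact ⟨n, hn, (hP n a').2 ⟨q, hq, H, hHc, hHd, hnot⟩⟩
  -- per n, a datum that is bad at the highest possible level ≤ n (or 0 if none)
  have key : ∀ n, ∃ q, ∃ H : MvPolynomial (↥(Literature.Barriers.ValiantsHypothesis.degLEMonomials n) ⊕ Fin q) ℂ,
      q ≤ (2 * n).choose n ^ a ∧ Literature.Computability.AlgebraicComplexity.complexity H ≤ (2 * n).choose n ^ a ∧
      H.totalDegree ≤ (2 * n).choose n ^ a ∧ ∀ a', a' ≤ n → P n a' →
        Literature.Computability.AlgebraicComplexity.boolSum H ∉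
          Literature.Barriers.ValiantsHypothesis.Distinguishers ℂ n a' := by
    intro n
    by_cases hex : ∃ a', a' ≤ n ∧ P n a'
    · obtain ⟨a₀, ha₀, hbad₀⟩ := hex
      obtain ⟨q, hq, H, hHc, hHd, hnot⟩ := (hP n _).1 (Nat.findGreatest_spec ha₀ hbad₀)
      exact ⟨q, H, hq, hHc, hHd, fun a' ha' hbad' hmem =>
        hnot (hDmono n _ _ (Nat.le_findGreatest ha' hbad') hmem)⟩
    · exact ⟨0, MvPolynomial.C 0, Nat.zero_le _,
        (Literature.Computability.AlgebraicComplexity.complexity_C_holds (0 : ℂ)).trans_le (Nat.zero_le _),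
        by simp, fun a' ha' hbad' => absurd ⟨a', ha', hbad'⟩ hex⟩
  choose q H hq hHc hHd hbest using key
  -- the diagonal family M ↦ boolSum (H (log₂ M)) is p-definable, hence p-computable under VP = VNP
  have hgVP : Literature.Computability.AlgebraicComplexity.IsVPFamily (fun M => H (Nat.log 2 M)) := by
    refine ⟨⟨pb _ 2 (2 * a + 3) fun M => ?_, pb _ 1 (2 * a) fun M => ?_⟩, pb _ 1 (2 * a) fun M => ?_⟩
    · rw [Fintype.card_sum, Fintype.card_fin]
      calc Fintype.card ↥(Literature.Barriers.ValiantsHypothesis.degLEMonomials (Nat.log 2 M)) + q (Nat.log 2 M)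
          ≤ (M + 1) ^ 3 + (M + 1) ^ (2 * a) := Nat.add_le_add (hcardM M) ((hq _).trans (hNMa M))
        _ ≤ (M + 1) ^ (2 * a + 3) + (M + 1) ^ (2 * a + 3) :=
            Nat.add_le_add (hmo M _ _ (by omega)) (hmo M _ _ (by omega))
        _ = 2 * (M + 1) ^ (2 * a + 3) := by ring
    · rw [one_mul]; exact (hHd _).trans (hNMa M)
    · rw [one_mul]; exact (hHc _).trans (hNMa M)
  have hfVNP : Literature.Computability.AlgebraicComplexity.IsVNPFamily
      (fun M => Literature.Computability.AlgebraicComplexity.boolSum (H (Nat.log 2 M))) := by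
    refine ⟨⟨pb _ 1 3 fun M => ?_, pb _ 1 (2 * a) fun M => ?_⟩,
      fun M => q (Nat.log 2 M), fun M => H (Nat.log 2 M), hgVP, fun M => rfl⟩
    · rw [one_mul]; exact hcardM M
    · rw [one_mul]; exact ((hdegB _ _ _).trans (hHd _)).trans (hNMa M)
  have hmem := (Literature.Computability.AlgebraicComplexity.mem_VNP_ofFintype_iff_holds _).2 hfVNP
  rw [← hVeq] at hmem
  obtain ⟨c, hc⟩ := ((Literature.Computability.AlgebraicComplexity.mem_VP_ofFintype_iff_holds _).1 hmem).2
  -- query the failure at level a + c + 1 beyond n₁ = a + c + 1, and compare at M = 2^n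
  obtain ⟨n, hn, hPn⟩ := hcon' (a + c + 1) (a + c + 1)
  refine hbest n (a + c + 1) hn hPn ⟨?_, ((hdegB _ _ (H n)).trans (hHd n)).trans
    (Nat.pow_le_pow_right (hNpos n) (by omega))⟩
  have h := hc (2 ^ n)
  beta_reduce at h
  rw [show Nat.log 2 (2 ^ n) = n from Nat.log_pow Nat.one_lt_two n] at h
  have h2n : 2 ≤ 2 ^ n := Nat.one_lt_two_pow (by omega)
  have hc2 : c ≤ 2 ^ c := Nat.lt_two_pow_self.le
  have hcc : 2 ^ c ≤ (2 ^ n) ^ c := Nat.pow_le_pow_left h2n c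
  calc _ ≤ (2 ^ n) ^ c + c := h
    _ ≤ (2 ^ n) ^ c * 2 := by omega
    _ ≤ (2 ^ n) ^ c * 2 ^ n := Nat.mul_le_mul_left _ h2n
    _ ≤ ((2 * n).choose n) ^ c * (2 * n).choose n := Nat.mul_le_mul (Nat.pow_le_pow_left (hcb n) c) (hcb n)
    _ = ((2 * n).choose n) ^ (c + 1) := by ring
    _ ≤ ((2 * n).choose n) ^ (a + c + 1) := Nat.pow_le_pow_right (hNpos n) (by omega)

end Summit.ValiantsHypothesis.Theorems
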